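import Summits.BirchSwinnertonDyer.BirchSwinnertonDyer.Theorems.PrintX9HowardContainmentPinnedOfSixLeavesIntended
import Summits.BirchSwinnertonDyer.BirchSwinnertonDyer.Theorems.HowardThm161PrintIntendedOfProp141
import HarnessLib

/-!
# DISPLAY-PROP141-X9 — row 9's A-side and display with Howard's Thm. 1.6.1 REPLACED by Howard's Prop. 1.4.1 / Thm. 1.4.2
# (Flach 1990's generalised Cassels–Tate pairing, the cite-only leaf C45.1′ `Howard2004.prop141_casselsTate_skewPairing_atLevel`):
# `howardContainmentLightFramePinned_of_prop141_kolyvaginSystem_cgs`, `bsdpOnClassX9_of_sixLeaves_prop141`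

Cell `pub/bsd-print-x9`, seat `bsd-line-x9-p1` LEAD g10; pen plan g15 GO 2026-08-29T10:18:59Z (names as here; trigger of the pen's r8 «straight to
the Flach leaf» consolidation); bsd-line-x10b-p1 LEAD g13 GO 10:19:25Z. `--supports` stmt-BirchSwinnertonDyer-22642 (helper). THEOREMS ONLY.

WHAT. The G87 ENGINE (cell-wide, 2026-08-28/29; closing theorem `Howard2004.DVRSetting.thm161_printIntended_of_prop141`, x10b-p1-w2 g17) proves
Howard 2004 Thm. 1.6.1 PRINT-AS-INTENDED (`thm161_dvrKolyvaginBound_printIntended`, F-161′) in the kernel from ONE cite-only print input —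
Howard's Prop. 1.4.1 with the displays of Thm. 1.4.2 (`prop141_casselsTate_skewPairing_atLevel`, Flach 1990) — and the Poitou–Tate duality of
Selmer structures, a THEOREM of the tree (`InputsPoitouTateSelmer.poitouTate_selmerStructure_duality_conj_holds`) — composed Summits-side
as `HowardThm161PrintIntended.thm161_printIntended_of_prop141 (h141) : F-161′` (x10b-p1-w2 g17). Composing with this seat's
T-161′-X9 (`PrintX9OfKolyvaginSystemLeafIntended`, p711754):
* **`howardContainmentLightFramePinned_of_prop141_kolyvaginSystem_cgs :
  prop141_casselsTate_skewPairing_atLevel → CGLSHeegnerKolyvaginSystem → CGSHowardDivisibilityPLocalized → HowardContainmentLightFramePinned`**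
  (item 26356's decl from C45.1′, F-411, CGS 6.5.2);
* **`bsdpOnClassX9_of_sixLeaves_prop141 (h141 hK hCGS hPT hHP hCP hT hμ) : Rank1Residual.BSDpOnClassX9`** — row 9's display from SIX cite-only
  leaves {C45.1′, F-411, CGS 6.5.2, `PinnedTransferPrintFacts`, `HeegnerPrintFactsX9`, `CyclotomicPrintFactsX9`} + the two K6 μ-inputs: the
  Howard leaf is now Prop. 1.4.1 (Flach), a strictly smaller print input than Thm. 1.6.1; Thm. 1.6.1-as-intended rides as a kernel theorem.
HONEST FRAMING: CONDITIONAL on the leaves named (statement-only print facts); no item is closed by this file; no route verb is implied.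
«beyond-print theorem»: no. No summit statement is proved; BSD is NOT proved by any of this.

References: [Howard2004HeegnerKolyvagin] Prop. 1.4.1, Thm. 1.4.2, Thm. 1.6.1; [Flach1990]; [CastellaGrossiLeeSkinner2022] Thm. 4.1.1, Rem. 4.1.4;
[CastellaGrossiSkinner2025] Thm. 6.5.2; [MilneADT2006] I Thm. 4.10.
-/

set_option linter.dupNamespace false
set_option autoImplicit false

noncomputable section

open Literature.NumberTheory.GaloisCohomology Literature.NumberTheory.GaloisCohomology.Howard2004
open Summit.BirchSwinnertonDyer.BirchSwinnertonDyer.Theses.PrintX9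
open Summit.BirchSwinnertonDyer.BirchSwinnertonDyer.Theorems

namespace Summit.BirchSwinnertonDyer.BirchSwinnertonDyer.Theorems.PrintX9OfFlachLeaf

/-- **`HowardContainmentLightFramePinned` (stmt-BirchSwinnertonDyer-26356) from Howard Prop. 1.4.1 (Flach, C45.1′), CGLS Thm. 4.1.1 in
Kolyvagin-system form (F-411) and CGS Thm. 6.5.2** — G2's `howardContainmentLightFramePinned_of_howardIntended_kolyvaginSystem_cgs` at the
engine's F-161′. CONDITIONAL on the three leaves. [cite: Howard2004HeegnerKolyvagin, Prop. 1.4.1, Thm. 1.4.2, Thm. 1.6.1]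
[cite: CastellaGrossiLeeSkinner2022, Thm. 4.1.1, Rem. 4.1.4] [cite: CastellaGrossiSkinner2025, Thm. 6.5.2] -/
theorem howardContainmentLightFramePinned_of_prop141_kolyvaginSystem_cgs :
    prop141_casselsTate_skewPairing_atLevel → CGLSHeegnerKolyvaginSystem → CGSHowardDivisibilityPLocalized →
      HowardContainmentLightFramePinned :=
  fun h141 ↦ PrintX9OfKolyvaginSystemLeafIntended.howardContainmentLightFramePinned_of_howardIntended_kolyvaginSystem_cgs
    (HowardThm161PrintIntended.thm161_printIntended_of_prop141 h141)

/-- **The deciding crux decl shape `HowardContainmentLightFramePinnedOfPrintSharp` (27077: `hMZ → hNV → hCGS → hTw♯ → A^pin`) from C45.1′ and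
F-411, `hMZ`, `hNV`, `hTw♯` idle** — for the pen's glue term. [cite: Howard2004HeegnerKolyvagin, Prop. 1.4.1, Thm. 1.6.1]
[cite: CastellaGrossiLeeSkinner2022, Thm. 4.1.1] [cite: CastellaGrossiSkinner2025, Thm. 6.5.2] -/
theorem howardContainmentLightFramePinnedOfPrintSharp_of_prop141_kolyvaginSystem (h141 : prop141_casselsTate_skewPairing_atLevel) :
    CGLSHeegnerKolyvaginSystem → HowardContainmentLightFramePinnedOfPrintSharp :=
  fun hKS _hMZ _hNV hCGS _hTw ↦ howardContainmentLightFramePinned_of_prop141_kolyvaginSystem_cgs h141 hKS hCGS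

/-- **DISPLAY — `BSD_p` on the X9 leaf from SIX cite-only print leaves, the Howard leaf being Prop. 1.4.1 (Flach 1990) instead of
Thm. 1.6.1**: C45.1′, CGLS 2022 Thm. 4.1.1 KS form (F-411), CGS 2025 Thm. 6.5.2, `PinnedTransferPrintFacts`, `HeegnerPrintFactsX9`,
`CyclotomicPrintFactsX9`, and `MuTransfer` / `AnalyticMuZeroX9` (items 19629 / 19630) — G2's `bsdpOnClassX9_of_sixLeaves_intended` at the
engine's F-161′. CONDITIONAL on the eight hypotheses; a display, not a closure. [cite: Howard2004HeegnerKolyvagin, Prop. 1.4.1, Thm. 1.4.2, Thm. 1.6.1, Thm. B]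
[cite: CastellaGrossiLeeSkinner2022, Thm. 4.1.1, Rem. 4.1.4] [cite: CastellaGrossiSkinner2025, Thm. 6.5.2] -/
theorem bsdpOnClassX9_of_sixLeaves_prop141
    (h141 : prop141_casselsTate_skewPairing_atLevel) (hK : CGLSHeegnerKolyvaginSystem) (hCGS : CGSHowardDivisibilityPLocalized)
    (hPT : PinnedTransferPrintFacts) (hHP : HeegnerPrintFactsX9) (hCP : CyclotomicPrintFactsX9)
    (hT : MuTransfer) (hμ : AnalyticMuZeroX9) :
    Summit.BirchSwinnertonDyer.BirchSwinnertonDyer.Rank1Residual.BSDpOnClassX9 :=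
  PrintX9OfKolyvaginSystemLeafIntended.bsdpOnClassX9_of_sixLeaves_intended (HowardThm161PrintIntended.thm161_printIntended_of_prop141 h141)
    hK hCGS hPT hHP hCP hT hμ

end Summit.BirchSwinnertonDyer.BirchSwinnertonDyer.Theorems.PrintX9OfFlachLeaf

end
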